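import Literature.Topology.FourManifolds.OneOneTransversalityComp
import Literature.Topology.FourManifolds.CuspGenericPoint
import HarnessLib

/-!
# Second-order generic maps from a closed 4-manifold to the plane exist

Topic `Literature/Topology/FourManifolds` (programme of the fact
`Literature.Topology.FourManifolds.exists_isSimplifiedBrokenLefschetzFibration`, Baykur–Saeki 2017, §2.1
p. 6: "the singularities of a generic map `X⁴ → Σ²` are folds and cusps", a special case of
Thom transversality).  `OneJetGenericMapsExist.lean` produced, on every compact boundaryless
`C^∞` 4-manifold, maps to the plane that are first-order generic at every point
(`j¹f ⋔ S₁`, rank `≥ 1`).  This file adds the SECOND-ORDER condition: the map may be chosen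
**cusp-generic at every point** (`OneJet.IsCuspGenericAt`: at every cusp candidate the
invariant cubic is non-zero — Whitney's simple-cusp condition, `CuspGenericPoint.lean`).

The proof is the globalisation pattern of `OneJet.ae_oneGeneric_manifold`: for a Whitney
embedding `ι : M → ℝᴺ` the global family `F_θ = f₀ + θ.1 ∘ ι + θ.2(ι, ι)` has chart
representatives `quadPerturbComp (f₀ ∘ φ⁻¹) (ι ∘ φ⁻¹) θ`; by
`OneJet.ae_twoGeneric_quadPerturbComp` almost every `θ` is good on each of finitely many chart
targets covering `M`; chartwise nondegeneracy gives cusp-genericity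
(`OneJet.isCuspGenericAt_of_charts`), which is transported to the chart at the point itself by
the invariance lemmas (`isOneJetTransverseAt_comp_iff`, `IsCuspGenericAt.comp_source`) through the
chart transition (`exists_transition₂`, `C^∞` on an open neighbourhood).

* `OneJet.isCuspGenericAt_congr_of_eventuallyEq` — locality;
* `OneJet.exists_transition₂` — the chart transition, `C^∞` on an open neighbourhood, with its
  invertible derivative and the conjugation of representatives;
* **`OneJet.ae_twoGeneric_manifold`** — for almost every `θ`, `F_θ` is, at every point and in the
  chart at that point, of rank `≥ 1`, 1-jet-transverse and cusp-generic;
* **`OneJet.exists_twoGeneric_map`** — every compact boundaryless `C^∞` 4-manifold carries a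
  `C^∞` map to `ℝ²` with these properties at every point.

Everything is proved; no definitions, no named facts (D-0026).

## References

* M. Golubitsky, V. Guillemin, *Stable Mappings and Their Singularities*, GTM 14 (1973), Ch. II
  §4, Thm. 4.9; Ch. VI §1 Def. 1.5, §2 Def. 2.3, §4, §5 Thm. 5.2. [GolubitskyGuillemin1973]
* V. Guillemin, A. Pollack, *Differential Topology* (1974), Ch. 2 §3. [GuilleminPollack2010]
* R. İ. Baykur, O. Saeki, *Simplifying indefinite fibrations on 4-manifolds*, arXiv:1705.11169,
  §2.1 p. 6, §6 p. 19. [BaykurSaeki2017]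
-/

noncomputable section

set_option maxSynthPendingDepth 2

open Set Function Filter MeasureTheory Module
open scoped ContDiff Topology Manifold

namespace Literature.Topology.FourManifolds

namespace OneJet

/-! ### Locality of cusp-genericity -/

section Congr

/-- Local notation for this file: the model space `ℝⁿ = EuclideanSpace ℝ (Fin n)`. -/
local notation "𝔼 " n:arg => EuclideanSpace ℝ (Fin n)

variable {E F : Type*} [NormedAddCommGroup E] [NormedSpace ℝ E] [NormedAddCommGroup F]
  [NormedSpace ℝ F]

/-- The cubic depends only on the germ of the map. [folklore] -/
theorem cubicForm_congr_of_eventuallyEq {g₁ g₂ : E → F} {x : E} (heq : g₁ =ᶠ[𝓝 x] g₂)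
    (ℓ μ : F →L[ℝ] ℝ) (k : E) (τ : ℝ) : cubicForm g₁ x ℓ μ k τ = cubicForm g₂ x ℓ μ k τ := by
  rw [cubicForm_def, cubicForm_def, heq.fderiv.fderiv_eq, heq.fderiv.fderiv.fderiv_eq]

/-- Cusp-genericity depends only on the germ of the map. [folklore] -/
theorem isCuspGenericAt_congr_of_eventuallyEq {g₁ g₂ : E → 𝔼 2} {x : E}
    (heq : g₁ =ᶠ[𝓝 x] g₂) : IsCuspGenericAt g₁ x ↔ IsCuspGenericAt g₂ x := by
  rw [isCuspGenericAt_iff, isCuspGenericAt_iff, heq.fderiv_eq, heq.fderiv.fderiv_eq]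
  refine forall_congr' fun ℓ => forall_congr' fun _ => forall_congr' fun _ =>
    forall_congr' fun k => forall_congr' fun _ => forall_congr' fun _ => forall_congr' fun _ =>
    forall_congr' fun μ => forall_congr' fun τ => forall_congr' fun _ => ?_
  rw [cubicForm_congr_of_eventuallyEq heq]

end Congr

/-! ### The chart transition, smooth on an open neighbourhood -/

section Manifold

/-- Local notation for this file: the model space `ℝⁿ = EuclideanSpace ℝ (Fin n)`. -/
local notation "𝔼 " n:arg => EuclideanSpace ℝ (Fin n)

variable {M : Type*} [TopologicalSpace M] [ChartedSpace (𝔼 4) M] [IsManifold (𝓡 4) ∞ M]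

/-- **The chart transition at a point of a common chart domain** (strengthening of
`OneJet.exists_transition`): `Θ = φ_p ∘ φ_q⁻¹` is `C^∞` on an open neighbourhood `U` of `φ_q q`
which it maps into the target of `φ_p`, has an invertible derivative at `φ_q q`, maps `φ_q q` to
`φ_p q`, and conjugates the chart representatives near `φ_q q`. [folklore] -/
theorem exists_transition₂ {p q : M} (hq : q ∈ (chartAt (𝔼 4) p).source) :
    ∃ (Θ : (𝔼 4) → 𝔼 4) (A : (𝔼 4) ≃L[ℝ] 𝔼 4) (U : Set (𝔼 4)),
      IsOpen U ∧ extChartAt (𝓡 4) q q ∈ U ∧ ContDiffOn ℝ ∞ Θ U ∧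
      MapsTo Θ U (extChartAt (𝓡 4) p).target ∧
      Θ (extChartAt (𝓡 4) q q) = extChartAt (𝓡 4) p q ∧
      HasFDerivAt Θ (A : (𝔼 4) →L[ℝ] 𝔼 4) (extChartAt (𝓡 4) q q) ∧
      ∀ {V : Type} (F : M → V),
        (F ∘ (extChartAt (𝓡 4) q).symm) =ᶠ[𝓝 (extChartAt (𝓡 4) q q)]
          ((F ∘ (extChartAt (𝓡 4) p).symm) ∘ Θ) := by
  set Θ : PartialEquiv (𝔼 4) (𝔼 4) :=
    (𝓡 4).extendCoordChange (chartAt (𝔼 4) q) (chartAt (𝔼 4) p) with hΘ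
  have hy₀ : extChartAt (𝓡 4) q q ∈ Θ.source := by
    rw [hΘ, ModelWithCorners.extendCoordChange_source]
    refine ⟨chartAt (𝔼 4) q q, ?_, rfl⟩
    simp only [OpenPartialHomeomorph.trans_source, OpenPartialHomeomorph.symm_source, mem_inter_iff,
      mem_preimage]
    refine ⟨mem_chart_target _ q, ?_⟩
    rw [(chartAt (𝔼 4) q).left_inv (mem_chart_source _ q)]
    exact hq
  have hΘo : IsOpen Θ.source := by
    rw [hΘ, ModelWithCorners.extendCoordChange_source]
    have : ((𝓡 4) : (𝔼 4) → 𝔼 4) = id := by ext x i; rfl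
    rw [this, image_id]
    exact ((chartAt (𝔼 4) q).symm ≫ₕ chartAt (𝔼 4) p).open_source
  have hΘs : ContDiffOn ℝ ∞ Θ Θ.source :=
    (𝓡 4).contDiffOn_extendCoordChange (IsManifold.chart_mem_maximalAtlas q)
      (IsManifold.chart_mem_maximalAtlas p)
  have hΘc : ContDiffAt ℝ ∞ Θ (extChartAt (𝓡 4) q q) := hΘs.contDiffAt (hΘo.mem_nhds hy₀)
  have hinv := (𝓡 4).isInvertible_fderivWithin_extendCoordChange (n := ∞) (by simp)
    (IsManifold.chart_mem_maximalAtlas q) (IsManifold.chart_mem_maximalAtlas p) hy₀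
  rw [fderivWithin_of_isOpen hΘo hy₀] at hinv
  obtain ⟨A, hA⟩ := hinv
  have hΘd : HasFDerivAt Θ (A : (𝔼 4) →L[ℝ] 𝔼 4) (extChartAt (𝓡 4) q q) := by
    rw [hA]
    exact (hΘc.differentiableAt (by simp)).hasFDerivAt
  have hΘq : Θ (extChartAt (𝓡 4) q q) = extChartAt (𝓡 4) p q := by
    change extChartAt (𝓡 4) p ((extChartAt (𝓡 4) q).symm (extChartAt (𝓡 4) q q)) = _
    rw [extChartAt_to_inv]
  -- the open neighbourhood mapped into the target of `φ_p`
  set U : Set (𝔼 4) := Θ.source ∩ Θ ⁻¹' (extChartAt (𝓡 4) p).target with hU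
  have hUo : IsOpen U := hΘs.continuousOn.isOpen_inter_preimage hΘo (isOpen_extChartAt_target p)
  have hqU : extChartAt (𝓡 4) q q ∈ U := by
    refine ⟨hy₀, ?_⟩
    rw [mem_preimage, hΘq]
    exact (extChartAt (𝓡 4) p).map_source (by rwa [extChartAt_source])
  refine ⟨Θ, A, U, hUo, hqU, hΘs.mono inter_subset_left, fun y hy => hy.2, hΘq, hΘd,
    fun F => ?_⟩
  have hsymm : ContinuousAt (extChartAt (𝓡 4) q).symm (extChartAt (𝓡 4) q q) :=
    continuousAt_extChartAt_symm q
  have hmem : ∀ᶠ y in 𝓝 (extChartAt (𝓡 4) q q),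
      (extChartAt (𝓡 4) q).symm y ∈ (chartAt (𝔼 4) p).source := by
    refine hsymm.preimage_mem_nhds ?_
    rw [extChartAt_to_inv]
    exact (chartAt (𝔼 4) p).open_source.mem_nhds hq
  filter_upwards [hmem] with y hy
  change F ((extChartAt (𝓡 4) q).symm y) =
    F ((extChartAt (𝓡 4) p).symm (extChartAt (𝓡 4) p ((extChartAt (𝓡 4) q).symm y)))
  rw [(extChartAt (𝓡 4) p).left_inv]
  rwa [extChartAt_source]

/-! ### Second-order generic maps on a closed 4-manifold -/

/-- Local notation: the parameter space of the global quadratic family through `ι : M → ℝᴺ`. -/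
local notation "PE " n:arg => (((𝔼 n) →L[ℝ] 𝔼 2) × ((𝔼 n) →L[ℝ] (𝔼 n) →L[ℝ] 𝔼 2))

omit [IsManifold (𝓡 4) ∞ M] in
/-- The chart representative in the chart at `p` of `f₀ + θ.1 ∘ ι + θ.2(ι, ι)` is the composite
family of the chart representatives. [folklore] -/
theorem comp_extChartAt_symm_quad {n : ℕ} (f₀ : M → 𝔼 2) (ι : M → 𝔼 n) (θ : PE n) (p : M) :
    ((fun x => f₀ x + θ.1 (ι x) + θ.2 (ι x) (ι x)) ∘ (extChartAt (𝓡 4) p).symm) =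
      quadPerturbComp (f₀ ∘ (extChartAt (𝓡 4) p).symm) (ι ∘ (extChartAt (𝓡 4) p).symm) θ :=
  rfl

omit [IsManifold (𝓡 4) ∞ M] in
/-- `f₀ + θ.1 ∘ ι + θ.2(ι, ι)` is `C^∞` on `M` when `f₀` and `ι` are. [folklore] -/
theorem contMDiff_quad {n : ℕ} {f₀ : M → 𝔼 2} (hf₀ : ContMDiff (𝓡 4) (𝓡 2) ∞ f₀) {ι : M → 𝔼 n}
    (hι : ContMDiff (𝓡 4) (𝓡 n) ∞ ι) (θ : PE n) :
    ContMDiff (𝓡 4) (𝓡 2) ∞ fun x => f₀ x + θ.1 (ι x) + θ.2 (ι x) (ι x) := by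
  have heq : (fun x => f₀ x + θ.1 (ι x) + θ.2 (ι x) (ι x)) =
      fun x => f₀ x + quadPerturb (fun _ : 𝔼 n => (0 : 𝔼 2)) θ (ι x) := by
    funext x
    simp [quadPerturb, add_assoc]
  rw [heq]
  exact hf₀.add ((contDiff_quadPoly θ).comp_contMDiff hι)

/-- **Second-order generic maps from almost every quadratic perturbation through an immersion**
(Thom's theorem at second order on a closed 4-manifold; Golubitsky–Guillemin II Thm. 4.9 with
VI Def. 1.5, Def. 2.3, §4–§5, by the quadratic family through an embedding).  Let `M` be a
compact boundaryless `C^∞` manifold modelled on `ℝ⁴`, `ι : M → ℝᴺ` a `C^∞` map with injective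
differential, `f₀ : M → ℝ²` a `C^∞` map and `μ` an additive Haar measure on
`Hom(ℝᴺ, ℝ²) × Bil(ℝᴺ × ℝᴺ, ℝ²)`.  Then for almost every `θ`, the map
`F_θ = f₀ + θ.1 ∘ ι + θ.2(ι, ι)` has at every point `q`, in the chart at `q`, a representative with
non-zero differential, 1-jet-transverse and cusp-generic at `φ_q q`.
[cite: GolubitskyGuillemin1973, Ch. II §4, Thm. 4.9; Ch. VI §1 Def. 1.5, §2 Def. 2.3, §5 Thm. 5.2]
[cite: GuilleminPollack2010, Ch. 2 §3] [cite: BaykurSaeki2017, §2.1, p. 6] -/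
theorem ae_twoGeneric_manifold [T2Space M] [CompactSpace M] {n : ℕ} {ι : M → 𝔼 n}
    (hι : ContMDiff (𝓡 4) (𝓡 n) ∞ ι) (hιinj : ∀ x : M, Injective (mfderiv (𝓡 4) (𝓡 n) ι x))
    {f₀ : M → 𝔼 2} (hf₀ : ContMDiff (𝓡 4) (𝓡 2) ∞ f₀) (μ : Measure (PE n)) [μ.IsAddHaarMeasure] :
    ∀ᵐ θ ∂μ, ∀ q : M,
      fderiv ℝ ((fun x => f₀ x + θ.1 (ι x) + θ.2 (ι x) (ι x)) ∘ (extChartAt (𝓡 4) q).symm)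
          (extChartAt (𝓡 4) q q) ≠ 0 ∧
        IsOneJetTransverseAt
          ((fun x => f₀ x + θ.1 (ι x) + θ.2 (ι x) (ι x)) ∘ (extChartAt (𝓡 4) q).symm)
          (extChartAt (𝓡 4) q q) ∧
        IsCuspGenericAt
          ((fun x => f₀ x + θ.1 (ι x) + θ.2 (ι x) (ι x)) ∘ (extChartAt (𝓡 4) q).symm)
          (extChartAt (𝓡 4) q q) := by
  -- a finite subcover by chart domains
  obtain ⟨t, ht⟩ := isCompact_univ.elim_finite_subcover (fun p : M => (chartAt (𝔼 4) p).source)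
    (fun p => (chartAt (𝔼 4) p).open_source) fun x _ => mem_iUnion.2 ⟨x, mem_chart_source _ x⟩
  -- the Euclidean theorem in each chart
  have hchart : ∀ p : M, ∀ᵐ θ ∂μ,
      (∀ y ∈ (extChartAt (𝓡 4) p).target,
        fderiv ℝ (quadPerturbComp (f₀ ∘ (extChartAt (𝓡 4) p).symm)
            (ι ∘ (extChartAt (𝓡 4) p).symm) θ) y ≠ 0 ∧
          IsOneJetTransverseAt (quadPerturbComp (f₀ ∘ (extChartAt (𝓡 4) p).symm)
            (ι ∘ (extChartAt (𝓡 4) p).symm) θ) y) ∧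
      ∀ a : Fin 4, ∀ i : Fin 2, ∀ u : Unknowns, u.1 ∈ (extChartAt (𝓡 4) p).target →
        oneOneSystem (EuclideanSpace.proj i) (EuclideanSpace.proj (i + 1)) a
            (quadPerturbComp (f₀ ∘ (extChartAt (𝓡 4) p).symm)
              (ι ∘ (extChartAt (𝓡 4) p).symm) θ) u = 0 →
          Surjective (fderiv ℝ (oneOneSystem (EuclideanSpace.proj i)
            (EuclideanSpace.proj (i + 1)) a (quadPerturbComp (f₀ ∘ (extChartAt (𝓡 4) p).symm)
              (ι ∘ (extChartAt (𝓡 4) p).symm) θ)) u) := by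
    intro p
    have hinjc : ∀ y ∈ (extChartAt (𝓡 4) p).target,
        Injective (fderiv ℝ (ι ∘ (extChartAt (𝓡 4) p).symm) y) := by
      intro y hy
      have hx : (extChartAt (𝓡 4) p).symm y ∈ (extChartAt (𝓡 4) p).source :=
        (extChartAt (𝓡 4) p).map_target hy
      have h := injective_chartDeriv (I := 𝓡 4) (e := ι) hx
        ((hι _).mdifferentiableAt (by simp)) (hιinj _)
      rw [(extChartAt (𝓡 4) p).right_inv hy] at h
      exact h
    exact ae_twoGeneric_quadPerturbComp μ (isOpen_extChartAt_target p)
      (contDiffOn_comp_extChartAt_symm_target (I := 𝓡 4) hf₀ p)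
      (contDiffOn_comp_extChartAt_symm_target (I := 𝓡 4) hι p) hinjc
  have hall := (eventually_all_finset t).2 fun p (_ : p ∈ t) => hchart p
  filter_upwards [hall] with θ hθ q
  obtain ⟨p, hpt, hqp⟩ : ∃ p ∈ t, q ∈ (chartAt (𝔼 4) p).source := by
    have := ht (mem_univ q)
    simpa only [mem_iUnion, exists_prop] using this
  obtain ⟨hA, hsys⟩ := hθ p hpt
  set Fm : M → 𝔼 2 := fun x => f₀ x + θ.1 (ι x) + θ.2 (ι x) (ι x) with hFm
  have hqs : q ∈ (extChartAt (𝓡 4) p).source := by rwa [extChartAt_source]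
  have hy : extChartAt (𝓡 4) p q ∈ (extChartAt (𝓡 4) p).target :=
    (extChartAt (𝓡 4) p).map_source hqs
  obtain ⟨h1, h2⟩ := hA _ hy
  -- the representative at `p` is `C^∞` on the chart target and cusp-generic at `φ_p q`
  have hgp : ContDiffOn ℝ ∞ (Fm ∘ (extChartAt (𝓡 4) p).symm) (extChartAt (𝓡 4) p).target := by
    rw [hFm, comp_extChartAt_symm_quad]
    exact contDiffOn_quadPerturbComp (contDiffOn_comp_extChartAt_symm_target (I := 𝓡 4) hf₀ p)
      (contDiffOn_comp_extChartAt_symm_target (I := 𝓡 4) hι p) θ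
  have h3 : IsCuspGenericAt (Fm ∘ (extChartAt (𝓡 4) p).symm) (extChartAt (𝓡 4) p q) := by
    rw [hFm, comp_extChartAt_symm_quad]
    refine isCuspGenericAt_of_charts (isOpen_extChartAt_target p) ?_ hy h1 h2 ?_
    · rw [← comp_extChartAt_symm_quad]
      exact hgp
    · intro a i c y' τ h0
      exact hsys a i (extChartAt (𝓡 4) p q, (c, (y', τ))) hy h0
  -- pass to the chart at `q` through the transition map
  obtain ⟨Θ, L, U, hUo, hqU, hΘs, hΘU, hΘq, hΘd, hΘF⟩ := exists_transition₂ (M := M) hqp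
  have heq := hΘF Fm
  have hΘc : ContDiffAt ℝ ∞ Θ (extChartAt (𝓡 4) q q) := hΘs.contDiffAt (hUo.mem_nhds hqU)
  have hgp2 : ContDiffAt ℝ 2 (Fm ∘ (extChartAt (𝓡 4) p).symm) (Θ (extChartAt (𝓡 4) q q)) := by
    rw [hΘq]
    exact (hgp.contDiffAt ((isOpen_extChartAt_target p).mem_nhds hy)).of_le (by norm_cast)
  have hgpd : DifferentiableAt ℝ (Fm ∘ (extChartAt (𝓡 4) p).symm) (Θ (extChartAt (𝓡 4) q q)) :=
    hgp2.differentiableAt (by simp)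
  refine ⟨?_, ?_, ?_⟩
  · -- non-vanishing differential
    rw [heq.fderiv_eq, fderiv_comp _ hgpd hΘd.differentiableAt, hΘd.fderiv, hΘq]
    intro h0
    apply h1
    rw [← comp_extChartAt_symm_quad]
    ext v i
    have := congrArg (fun φ : (𝔼 4) →L[ℝ] 𝔼 2 => φ (L.symm v) i) h0
    simpa using this
  · -- 1-jet transversality
    rw [isOneJetTransverseAt_congr_of_eventuallyEq heq,
      isOneJetTransverseAt_comp_iff L hΘd (hΘc.of_le (by norm_cast)) hgp2, hΘq]
    rw [← comp_extChartAt_symm_quad] at h2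
    exact h2
  · -- cusp-genericity
    rw [isCuspGenericAt_congr_of_eventuallyEq heq]
    rw [← hΘq] at h3
    exact h3.comp_source (isOpen_extChartAt_target p) hgp hUo hΘs hΘU hqU hΘd

/-- **Every compact boundaryless `C^∞` 4-manifold admits a second-order generic map to the
plane** (Thom, via Golubitsky–Guillemin II Thm. 4.9 / VI Def. 1.5, Def. 2.3, Thm. 5.2 and the
Whitney embedding theorem): there is a `C^∞` map `f : M → ℝ²` which at every point `q`, read in
the chart at `q`, has non-zero differential, is 1-jet-transverse (`j¹f ⋔ S₁`: regular points,
fold points and cusp candidates only) and is cusp-generic (every cusp candidate is a simple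
cusp) — the genericity from which Baykur–Saeki's proof of Thm. 6.1 starts (§2.1 p. 6, §6 p. 19).
[cite: BaykurSaeki2017, §2.1 p. 6, §6 p. 19]
[cite: GolubitskyGuillemin1973, Ch. II §4, Thm. 4.9; Ch. VI §1 Def. 1.5, §2 Def. 2.3, §5 Thm. 5.2] -/
theorem exists_twoGeneric_map (M : Type*) [TopologicalSpace M] [T2Space M] [CompactSpace M]
    [ChartedSpace (𝔼 4) M] [IsManifold (𝓡 4) ∞ M] :
    ∃ f : M → 𝔼 2, ContMDiff (𝓡 4) (𝓡 2) ∞ f ∧ ∀ q : M,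
      fderiv ℝ (f ∘ (extChartAt (𝓡 4) q).symm) (extChartAt (𝓡 4) q q) ≠ 0 ∧
      IsOneJetTransverseAt (f ∘ (extChartAt (𝓡 4) q).symm) (extChartAt (𝓡 4) q q) ∧
      IsCuspGenericAt (f ∘ (extChartAt (𝓡 4) q).symm) (extChartAt (𝓡 4) q q) := by
  obtain ⟨n, ι, hι, -, hιinj⟩ := exists_embedding_euclidean_of_compact (I := 𝓡 4) (M := M)
  have hf₀ : ContMDiff (𝓡 4) (𝓡 2) ∞ (fun _ : M => (0 : 𝔼 2)) := contMDiff_const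
  obtain ⟨θ, hθ⟩ :=
    (ae_twoGeneric_manifold hι hιinj hf₀ (Measure.addHaar : Measure (PE n))).exists
  exact ⟨fun x => (0 : 𝔼 2) + θ.1 (ι x) + θ.2 (ι x) (ι x), contMDiff_quad hf₀ hι θ, hθ⟩

end Manifold

end OneJet

end Literature.Topology.FourManifolds
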